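import Mathlib
import HarnessLib
import Literature.Analysis.FluidPDE.LocalTypeI
import Summits.NavierStokesRegularity.NavierStokesRegularity.Theorems.PoloidalWindowDoorPoloidalWindowRigidityZShockSlopeFunctionSourceLocal

/-!
# Crux K2 `PoloidalWindowRigidity` (stmt-NavierStokesRegularity-19708), line `z_shock` — the DECIDING STUB `stub_zShockThickAut`
# REDUCED IN THE KERNEL to the located residual of K2-p2's stratum (SF) («passive Clebsch weight with a `(t, x₂)`-source»)

`--supports stmt-NavierStokesRegularity-19708 --as helper` (leafhand-ns-poloidalwindowdoor-3 g13, cell decomp-ns, 2026-08-31).  Def-free.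
**No stub and no summit is closed by this file; Navier–Stokes regularity is NOT proved here (rung 0).**

g12's `…ZShockAutReduction` reduced the deciding stub to the KINEMATIC lever (the class-free slice Liouville statement `hGN`, XL, + the
(TV)-instant residue).  Bridges B1–B3 of this hand (`…ZShockSlopeFunctionSpaceTime`, `…ZShockSlopeFunctionPressureLocal`,
`…ZShockSlopeFunctionSourceLocal`) identify the Aut column, locally off `{∇ₕv₂ = 0}`, with K2-p2's stratum (SF) and carry its
Navier–Stokes identities (pressure law, horizontally constant Clebsch source) onto it.  This file does the bookkeeping: the theorem
`stub_zShockThickAut_of_sfResidual` has EXACTLY the registered type of `stub_zShockThickAut` (skeleton sha16 c3e8eee2) as conclusion and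
ONE hypothesis `hSF` = the stub with its autonomy clause `∃ g W₁ ∋ z₀, ∂_z v_b = g(t,v₂)∂_b v₂ on W₁` REPLACED by the (SF) structure it
generates near `z₀`: a jointly `C^∞` slope antiderivative `G`, an open `O ∋ z₀` inside the window with the (SF) constraint
`∂_z v_b = ∂_sG(t,v₂)∂_b v₂` on `O`, AND the passive-scalar law `∇ₕ[(1 − ∂_sG)f₂ − ∂ₜG + ∂_s²G‖∇v₂‖²] = 0` on `O` (the source of the
Clebsch weight `v₂ − G(t,v₂)` depends on `(t, x₂)` only), PLUS the stub's `hpin` in (SF) currency: `∂_s²G(t,v₂) ≠ 0` at points of every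
neighbourhood of `z₀` (`exists_gn_point_of_not_tv`: genuine nonlinearity).  So the deciding stub is ALSO the DYNAMICAL statement «no thick hyperbolic
twisting window of a class profile carries, near a densely-hyperbolic-slice point, the (SF) structure with a height-dependent-only
freedom in the Clebsch source» — K2-p2's located residual B4 (`…SlopeFunctionPassive` empties the height-FREE sub-case globally), now with
the stub's exact type.  A planner may re-cut the Aut column by `hSF` (NS dynamics) instead of / next to `hGN` (kinematics).
HONEST LABEL: a reduction (repair census in the kernel); `hSF` is L–XL. [folklore]
-/

noncomputable section

namespace Summit.NavierStokesRegularity.NavierStokesRegularity.Theorems.PoloidalWindowDoorPoloidalWindowRigidityZShockSFReduction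

-- the problem directory repeats the summit name (`NavierStokesRegularity/NavierStokesRegularity`)
set_option linter.dupNamespace false

open Set Filter Topology Function InnerProductSpace
open scoped RealInnerProductSpace InnerProductSpace Laplacian ContDiff
open Literature.Analysis Literature.Analysis.FluidPDE
open Summit.NavierStokesRegularity.NavierStokesRegularity.Theorems.LocalSineTubeDoorProfileAlignedWindowRigidityAncient
open Summit.NavierStokesRegularity.NavierStokesRegularity.Theorems.PoloidalWindowDoorPoloidalWindowRigidityZShockSlopeFunctionSourceLocal
open Metric

/-- **The stub's `hpin` («not (TV) on any sub-window») in (SF) currency: genuine nonlinearity `∂_s²G ≠ 0` near `z₀`.**  If the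
(SF) constraint `∂_z v_b = ∂_sG(t,v₂)∂_b v₂` holds on an open `O ⊆ W` (`G ∈ C³(ℝ²)`, slices of `v₂` differentiable on `O`) and no open
nonempty sub-window of `W` carries a time-only slope, then every open `O' ∋ z₀` inside `O` contains a point with
`∂_s²G(t, v₂(t,x)) ≠ 0` (else `y ↦ ∂_sG(t,v₂(t,y))` is locally constant on slices: a (TV) sub-window). [folklore] -/
theorem exists_gn_point_of_not_tv {v : ℝ → EuclideanSpace ℝ (Fin 3) → EuclideanSpace ℝ (Fin 3)}
    {W O O' : Set (ℝ × EuclideanSpace ℝ (Fin 3))} {G : ℝ → ℝ → ℝ} {z₀ : ℝ × EuclideanSpace ℝ (Fin 3)}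
    (hG : ContDiff ℝ 3 (Function.uncurry G))
    (hv : ∀ z ∈ O, DifferentiableAt ℝ (fun y => v z.1 y 2) z.2)
    (hpin : ∀ m : ℝ → ℝ, ∀ W₁ : Set (ℝ × EuclideanSpace ℝ (Fin 3)), W₁ ⊆ W → IsOpen W₁ → W₁.Nonempty →
      ∃ z ∈ W₁, ∃ b : Fin 3, b ≠ 2 ∧
        fderiv ℝ (v z.1) z.2 (EuclideanSpace.single 2 1) b ≠
          m z.1 * fderiv ℝ (v z.1) z.2 (EuclideanSpace.single b 1) 2)
    (hOW : O ⊆ W)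
    (hslope : ∀ z ∈ O, ∀ b : Fin 3, b ≠ 2 →
      fderiv ℝ (v z.1) z.2 (EuclideanSpace.single 2 1) b =
        deriv (G z.1) (v z.1 z.2 2) * fderiv ℝ (v z.1) z.2 (EuclideanSpace.single b 1) 2)
    (hO' : IsOpen O') (hz₀ : z₀ ∈ O') (hO'O : O' ⊆ O) :
    ∃ z ∈ O', deriv (deriv (G z.1)) (v z.1 z.2 2) ≠ 0 := by
  by_contra h
  push Not at h
  -- a product ball inside `O'`
  obtain ⟨r, hr, hball⟩ := Metric.isOpen_iff.1 hO' z₀ hz₀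
  have hprod : Metric.ball z₀.1 r ×ˢ Metric.ball z₀.2 r ⊆ O' := by
    rw [ball_prod_same, Prod.mk.eta]; exact hball
  -- `∂_sG(t,·)` is `C²`, `∂_s²G(t,·)` is `C¹`
  have hG' : ∀ t, ContDiff ℝ 2 (deriv (G t)) := fun t =>
    (contDiff_succ_iff_deriv.1 ((hG.comp (contDiff_const.prodMk contDiff_id)) :
      ContDiff ℝ ((2 : ℕ∞) + 1 : ℕ∞) (G t))).2.2
  -- on each slice of the product ball, `y ↦ ∂_sG(t, v₂(t,y))` is constant
  have hconst : ∀ t ∈ Metric.ball z₀.1 r, ∀ y ∈ Metric.ball z₀.2 r,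
      deriv (G t) (v t y 2) = deriv (G t) (v t z₀.2 2) := by
    intro t ht y hy
    have hdiff : ∀ y' ∈ Metric.ball z₀.2 r, HasFDerivAt (fun y => deriv (G t) (v t y 2))
        (deriv (deriv (G t)) (v t y' 2) • fderiv ℝ (fun y => v t y 2) y') y' := by
      intro y' hy'
      have hzO : (t, y') ∈ O := hO'O (hprod (Set.mk_mem_prod ht hy'))
      exact (((hG' t).differentiable (by norm_num)) _).hasDerivAt.comp_hasFDerivAt y' (hv (t, y') hzO).hasFDerivAt
    refine (isOpen_ball.is_const_of_fderiv_eq_zero (convex_ball z₀.2 r).isPreconnected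
      (fun y' hy' => (hdiff y' hy').differentiableAt.differentiableWithinAt) (fun y' hy' => ?_) hy (mem_ball_self hr))
    rw [(hdiff y' hy').fderiv, h (t, y') (hprod (Set.mk_mem_prod ht hy')), zero_smul]
    rfl
  -- hence a (TV) sub-window, contradicting `hpin`
  obtain ⟨z, hz, b, hb, hne⟩ := hpin (fun t => deriv (G t) (v t z₀.2 2)) (Metric.ball z₀.1 r ×ˢ Metric.ball z₀.2 r)
    ((hprod.trans hO'O).trans hOW) (isOpen_ball.prod isOpen_ball)
    ⟨z₀, Set.mk_mem_prod (mem_ball_self hr) (mem_ball_self hr)⟩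
  obtain ⟨hz1, hz2⟩ := Set.mem_prod.1 hz
  exact hne (by rw [hslope z (hO'O (hprod hz)) b hb, hconst z.1 hz1 z.2 hz2])

/-- **The deciding stub `stub_zShockThickAut` of line `z_shock`, reduced to the located residual of the stratum (SF).**  The
conclusion is the registered type of `stub_zShockThickAut` VERBATIM; the hypothesis `hSF` is the same statement with the local autonomy
clause replaced by the (SF) structure with passive Clebsch source near `z₀` (see the module docstring).  Proof: bridges B1–B3
(`clebschSource_horizConst_of_class_autonomy`) at the window point `z₀` (where `∇ₕv₂ ≠ 0` by the non-degeneracy pins), intersected with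
the window. [folklore] -/
theorem stub_zShockThickAut_of_sfResidual
    (hSF : ∀ (C : ℝ) (v : ℝ → EuclideanSpace ℝ (Fin 3) → EuclideanSpace ℝ (Fin 3)),
      Literature.Analysis.FluidPDE.HasTypeITimeDecay C v →
      ContinuousOn (Function.uncurry v) (Set.Iio (0 : ℝ) ×ˢ Set.univ) →
      (∀ s t : ℝ, s < t → t < 0 → ∀ x, v t x =
        Literature.Analysis.UnboundedOperators.heatExtension (v s) (t - s) x -
          Literature.Analysis.FluidPDE.oseenDuhamel 1 s v v t x) →
      (∀ t < 0, Literature.Analysis.FluidPDE.VectorCalculus.IsDivFree (v t)) →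
      (∀ s < 0, ∀ y, ⟪Literature.Analysis.FluidPDE.curl (v s) y, EuclideanSpace.single 2 1⟫_ℝ = 0) →
      ∀ W : Set (ℝ × EuclideanSpace ℝ (Fin 3)), IsOpen W → W.Nonempty → W ⊆ Set.Iio (0 : ℝ) ×ˢ Set.univ →
        (∀ z ∈ W, Literature.Analysis.FluidPDE.curl (v z.1) z.2 ≠ 0 ∧
          (fderiv ℝ (v z.1) z.2 (EuclideanSpace.single 0 1) 2 ≠ 0 ∨ fderiv ℝ (v z.1) z.2 (EuclideanSpace.single 1 1) 2 ≠ 0) ∧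
          (fderiv ℝ (v z.1) z.2 (EuclideanSpace.single 2 1) 0 ≠ 0 ∨ fderiv ℝ (v z.1) z.2 (EuclideanSpace.single 2 1) 1 ≠ 0)) →
        (∀ m : ℝ → ℝ, ∀ W₁ : Set (ℝ × EuclideanSpace ℝ (Fin 3)), W₁ ⊆ W → IsOpen W₁ → W₁.Nonempty →
          ∃ z ∈ W₁, ∃ b : Fin 3, b ≠ 2 ∧
            fderiv ℝ (v z.1) z.2 (EuclideanSpace.single 2 1) b ≠
              m z.1 * fderiv ℝ (v z.1) z.2 (EuclideanSpace.single b 1) 2) →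
        (∀ z ∈ W,
          fderiv ℝ (fun x => fderiv ℝ (v z.1) x (EuclideanSpace.single 2 1) 2) z.2 (EuclideanSpace.single 0 1) *
              fderiv ℝ (v z.1) z.2 (EuclideanSpace.single 1 1) 2 -
            fderiv ℝ (fun x => fderiv ℝ (v z.1) x (EuclideanSpace.single 2 1) 2) z.2 (EuclideanSpace.single 1 1) *
              fderiv ℝ (v z.1) z.2 (EuclideanSpace.single 0 1) 2 ≠ 0) →
        (∀ z ∈ W,
          fderiv ℝ (v z.1) z.2 (EuclideanSpace.single 2 1) 0 * fderiv ℝ (v z.1) z.2 (EuclideanSpace.single 0 1) 2 +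
            fderiv ℝ (v z.1) z.2 (EuclideanSpace.single 2 1) 1 * fderiv ℝ (v z.1) z.2 (EuclideanSpace.single 1 1) 2 < 0) →
        (∀ m : ℝ → ℝ → ℝ, ∀ W₁ : Set (ℝ × EuclideanSpace ℝ (Fin 3)), W₁ ⊆ W → IsOpen W₁ → W₁.Nonempty →
          ∃ z ∈ W₁, ∃ b : Fin 3, b ≠ 2 ∧
            fderiv ℝ (v z.1) z.2 (EuclideanSpace.single 2 1) b ≠
              m z.1 (z.2 2) * fderiv ℝ (v z.1) z.2 (EuclideanSpace.single b 1) 2) →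
        ∀ z₀ ∈ W, Dense {y : EuclideanSpace ℝ (Fin 3) |
            fderiv ℝ (v z₀.1) y (EuclideanSpace.single 2 1) 0 * fderiv ℝ (v z₀.1) y (EuclideanSpace.single 0 1) 2 +
              fderiv ℝ (v z₀.1) y (EuclideanSpace.single 2 1) 1 * fderiv ℝ (v z₀.1) y (EuclideanSpace.single 1 1) 2 < 0} →
        ∀ G : ℝ → ℝ → ℝ, ContDiff ℝ ∞ (Function.uncurry G) →
        ∀ O : Set (ℝ × EuclideanSpace ℝ (Fin 3)), IsOpen O → z₀ ∈ O → O ⊆ W →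
          (∀ z ∈ O, ∀ b : Fin 3, b ≠ 2 →
            fderiv ℝ (v z.1) z.2 (EuclideanSpace.single 2 1) b =
              deriv (G z.1) (v z.1 z.2 2) * fderiv ℝ (v z.1) z.2 (EuclideanSpace.single b 1) 2) →
          (∀ z ∈ O, ∀ b : Fin 3, b ≠ 2 →
            fderiv ℝ (fun y =>
                (1 - deriv (G z.1) (v z.1 y 2)) *
                    (Literature.Analysis.FluidPDE.timeDerivWithin (Set.Iio 0) v z.1 y +
                      Literature.Analysis.FluidPDE.convect (v z.1) (v z.1) y - Δ (v z.1) y) 2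
                  - deriv (fun τ => G τ (v z.1 y 2)) z.1
                  + deriv (deriv (G z.1)) (v z.1 y 2) *
                      ∑ i : Fin 3, fderiv ℝ (v z.1) y (EuclideanSpace.single i 1) 2 ^ 2) z.2
              (EuclideanSpace.single b 1) = 0) →
          (∀ O' : Set (ℝ × EuclideanSpace ℝ (Fin 3)), IsOpen O' → z₀ ∈ O' → O' ⊆ O →
            ∃ z ∈ O', deriv (deriv (G z.1)) (v z.1 z.2 2) ≠ 0) →
        ¬ Literature.Analysis.FluidPDE.IsBackwardSingularPoint v 0) :
    ∀ (C : ℝ) (v : ℝ → EuclideanSpace ℝ (Fin 3) → EuclideanSpace ℝ (Fin 3)),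
      Literature.Analysis.FluidPDE.HasTypeITimeDecay C v →
      ContinuousOn (Function.uncurry v) (Set.Iio (0 : ℝ) ×ˢ Set.univ) →
      (∀ s t : ℝ, s < t → t < 0 → ∀ x, v t x =
        Literature.Analysis.UnboundedOperators.heatExtension (v s) (t - s) x -
          Literature.Analysis.FluidPDE.oseenDuhamel 1 s v v t x) →
      (∀ t < 0, Literature.Analysis.FluidPDE.VectorCalculus.IsDivFree (v t)) →
      (∀ s < 0, ∀ y, ⟪Literature.Analysis.FluidPDE.curl (v s) y, EuclideanSpace.single 2 1⟫_ℝ = 0) →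
      ∀ W : Set (ℝ × EuclideanSpace ℝ (Fin 3)), IsOpen W → W.Nonempty → W ⊆ Set.Iio (0 : ℝ) ×ˢ Set.univ →
        (∀ z ∈ W, Literature.Analysis.FluidPDE.curl (v z.1) z.2 ≠ 0 ∧
          (fderiv ℝ (v z.1) z.2 (EuclideanSpace.single 0 1) 2 ≠ 0 ∨ fderiv ℝ (v z.1) z.2 (EuclideanSpace.single 1 1) 2 ≠ 0) ∧
          (fderiv ℝ (v z.1) z.2 (EuclideanSpace.single 2 1) 0 ≠ 0 ∨ fderiv ℝ (v z.1) z.2 (EuclideanSpace.single 2 1) 1 ≠ 0)) →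
        (∀ m : ℝ → ℝ, ∀ W₁ : Set (ℝ × EuclideanSpace ℝ (Fin 3)), W₁ ⊆ W → IsOpen W₁ → W₁.Nonempty →
          ∃ z ∈ W₁, ∃ b : Fin 3, b ≠ 2 ∧
            fderiv ℝ (v z.1) z.2 (EuclideanSpace.single 2 1) b ≠
              m z.1 * fderiv ℝ (v z.1) z.2 (EuclideanSpace.single b 1) 2) →
        (∀ z ∈ W,
          fderiv ℝ (fun x => fderiv ℝ (v z.1) x (EuclideanSpace.single 2 1) 2) z.2 (EuclideanSpace.single 0 1) *
              fderiv ℝ (v z.1) z.2 (EuclideanSpace.single 1 1) 2 -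
            fderiv ℝ (fun x => fderiv ℝ (v z.1) x (EuclideanSpace.single 2 1) 2) z.2 (EuclideanSpace.single 1 1) *
              fderiv ℝ (v z.1) z.2 (EuclideanSpace.single 0 1) 2 ≠ 0) →
        (∀ z ∈ W,
          fderiv ℝ (v z.1) z.2 (EuclideanSpace.single 2 1) 0 * fderiv ℝ (v z.1) z.2 (EuclideanSpace.single 0 1) 2 +
            fderiv ℝ (v z.1) z.2 (EuclideanSpace.single 2 1) 1 * fderiv ℝ (v z.1) z.2 (EuclideanSpace.single 1 1) 2 < 0) →
        (∀ m : ℝ → ℝ → ℝ, ∀ W₁ : Set (ℝ × EuclideanSpace ℝ (Fin 3)), W₁ ⊆ W → IsOpen W₁ → W₁.Nonempty →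
          ∃ z ∈ W₁, ∃ b : Fin 3, b ≠ 2 ∧
            fderiv ℝ (v z.1) z.2 (EuclideanSpace.single 2 1) b ≠
              m z.1 (z.2 2) * fderiv ℝ (v z.1) z.2 (EuclideanSpace.single b 1) 2) →
        ∀ z₀ ∈ W, Dense {y : EuclideanSpace ℝ (Fin 3) |
            fderiv ℝ (v z₀.1) y (EuclideanSpace.single 2 1) 0 * fderiv ℝ (v z₀.1) y (EuclideanSpace.single 0 1) 2 +
              fderiv ℝ (v z₀.1) y (EuclideanSpace.single 2 1) 1 * fderiv ℝ (v z₀.1) y (EuclideanSpace.single 1 1) 2 < 0} →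
        (∃ g : ℝ → ℝ → ℝ, ∃ W₁ : Set (ℝ × EuclideanSpace ℝ (Fin 3)), W₁ ⊆ W ∧ IsOpen W₁ ∧ z₀ ∈ W₁ ∧
          ∀ z ∈ W₁, ∀ b : Fin 3, b ≠ 2 →
            fderiv ℝ (v z.1) z.2 (EuclideanSpace.single 2 1) b =
              g z.1 (v z.1 z.2 2) * fderiv ℝ (v z.1) z.2 (EuclideanSpace.single b 1) 2) →
        ¬ Literature.Analysis.FluidPDE.IsBackwardSingularPoint v 0 := by
  intro C v hrate hcont hmild hdiv hpol W hW hWne hWs hnd hpin htw hhyp hthick z₀ hz₀ hD hA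
  obtain ⟨g, W₁, hW₁W, hW₁o, hz₀W₁, haut⟩ := hA
  have hW₁s : W₁ ⊆ Set.Iio (0 : ℝ) ×ˢ Set.univ := hW₁W.trans hWs
  have ht₀ : z₀.1 < 0 := (Set.mem_prod.1 (hWs hz₀)).1
  have hx₀ := (hnd z₀ hz₀).2.1
  obtain ⟨G, hGc, O, hOo, hz₀O, hOs, hslope, hsrc⟩ :=
    clebschSource_horizConst_of_class_autonomy hrate hcont hmild hdiv hpol hW₁o hW₁s ⟨z₀, hz₀W₁⟩ haut ht₀ hx₀
  have hz₀O' : z₀ ∈ O := by simpa using hz₀O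
  -- slices of `v₂` are differentiable on the slab (analytic slices)
  have hv2 : ∀ z ∈ O ∩ W, DifferentiableAt ℝ (fun y => v z.1 y 2) z.2 := by
    intro z hz
    have hz1 : z.1 < 0 := (Set.mem_prod.1 (hWs hz.2)).1
    have hd : DifferentiableAt ℝ (v z.1) z.2 :=
      (analyticOnNhd_slice hcont (bdd_of_hasTypeITimeDecay hrate) hmild hz1 z.2 (Set.mem_univ _)).differentiableAt
    exact ((EuclideanSpace.proj (𝕜 := ℝ) (2 : Fin 3) : EuclideanSpace ℝ (Fin 3) →L[ℝ] ℝ).differentiableAt).comp z.2 hd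
  have hslope' : ∀ z ∈ O ∩ W, ∀ b : Fin 3, b ≠ 2 →
      fderiv ℝ (v z.1) z.2 (EuclideanSpace.single 2 1) b =
        deriv (G z.1) (v z.1 z.2 2) * fderiv ℝ (v z.1) z.2 (EuclideanSpace.single b 1) 2 :=
    fun z hz b hb => hslope z hz.1 b hb
  exact hSF C v hrate hcont hmild hdiv hpol W hW hWne hWs hnd hpin htw hhyp hthick z₀ hz₀ hD G hGc (O ∩ W) (hOo.inter hW)
    ⟨hz₀O', hz₀⟩ Set.inter_subset_right hslope' (fun z hz b hb => hsrc z hz.1 b hb)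
    (fun O' hO' hz₀' hO'O => exists_gn_point_of_not_tv (hGc.of_le (by norm_cast)) hv2 hpin Set.inter_subset_right hslope'
      hO' hz₀' hO'O)

end Summit.NavierStokesRegularity.NavierStokesRegularity.Theorems.PoloidalWindowDoorPoloidalWindowRigidityZShockSFReduction

end
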